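import Summits.QuantumFields.YangMills.Theorems.BalabanUVNodesN15KingModelReflectionPositivityCharFun
import Summits.QuantumFields.YangMills.Theorems.BalabanUVNodesN15KingModelGaussianLawIdentification

/-!
# BalabanUVNodes ∕ N15 — THE KING-MODEL RUNG (PART Ϻ-s): CONVERGENCE OF THE FINITE-DIMENSIONAL DISTRIBUTIONS — the characteristic functionals of King's finite-volume `K = ∞` block-field
# laws converge to those of `μ_∞`: `∫e^{iΣ_jc_jφ(z_j mod Ω_k)}ρ_{P_∞,Ω_k} → ∫e^{iΣ_jc_jφ(z_j)}dμ_∞` as all periods of `Ω_k` tend to `∞` (Lévy's form of the thermodynamic limit)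
# (Track A, DAG node N15 = NE2; FAN-OUT v1.1 §N15 s3 «KING-MODEL RUNG»; uses parts Ϝ-s (`gaussLaw`, its complex MGF), Ϸ-d (`kingS2Lim → S₂^{ℝ}`), Ϻ-n∕r (`μ_∞`, its characteristic functionals);
# count-neutral)

HONEST FRAMING.  Count-neutral (cell `pub-ymgap`, seat `pub-ymgap-dag-n15-e` g35; `--supports stmt-QuantumFields-27366 --as helper` = K3⁸).  King's `A = 0`, `g = 0` model
([King1986] C. King, Commun. Math. Phys. **102** (1986) 649–677).  Part Ϻ-n proved that every `n`-point function of the finite-volume `K = ∞` block field converges to the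
corresponding moment of `μ_∞`.  THIS FILE proves the convergence of the CHARACTERISTIC FUNCTIONALS, i.e. of ALL FINITE-DIMENSIONAL DISTRIBUTIONS in Lévy's sense: for sites
`z_j ∈ ℤ^{d+1}`, real coefficients `c_j` and any unit tori `Ω_k` with all periods `→ ∞`,
`∫ e^{iΣ_jc_jφ(z_j mod Ω_k)} dρ_{P_∞,Ω_k}(φ) = exp(−½Σ_{j,j′}c_jc_{j′}S₂^{(∞)}_{Ω_k}(z_j, z_{j′}))` (part Ϝ-s's complex MGF of the Gaussian law `ρ_{P_∞}`, `P_∞⁻¹ = S₂^{(∞)}`)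
`→ exp(−½Σ_{j,j′}c_jc_{j′}S₂^{ℝ}(z_{j′} − z_j)) = ∫e^{iΣ_jc_jφ(z_j)}dμ_∞` (part Ϸ-d's `S₂^{(∞)}_{Ω_k} → S₂^{ℝ}`, part Ϻ-r's characteristic functional of `μ_∞`).  NOT Bałaban's objects; NOT a
node discharge; nothing continuum-Yang–Mills ∕ `ℝ⁴` ∕ OS ∕ Clay; weak convergence of the laws as measures on `ℝ^{ℤ^{d+1}}` (Lévy's continuity theorem on the product space) is NOT
typed — only the convergence of every finite-dimensional characteristic function.  0 `sorry`, 0 def; standard axioms.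

WHAT THIS FILE PROVES (kernel).  §1 `dot_siteIndicator_eq_sum` (`J⬝φ = Σ_jc_jφ(b_j)` for `J = Σ_jc_jδ_{b_j}`), `dot_mulVec_siteIndicator_eq_sum`,
★★ **`integral_cexp_I_fieldSum_fineBlockLawLim`** (the finite-volume characteristic functional in closed form).  §2 ★★★ **`tendsto_charFun_volume_kingFieldInf`**.

HONEST SCOPE.  King's free model; `K = ∞` laws on finite tori and their infinite-volume limit.  N15 untouched; counts unmoved.  Locators (use): [King1986] Thm 2.1 (2.22)–(2.23) p.654,
(2.6) p.652, (4.5) p.670.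
-/

noncomputable section

open scoped BigOperators Topology Matrix
open Filter MeasureTheory ProbabilityTheory Finset Complex

namespace Summit.QuantumFields.YangMills.BalabanUVNodes.N15KingModelRung.InfiniteVolume

open Literature.MathematicalPhysics.QuantumFieldTheory.Balaban1983to89.B5Prop11Plancherel (Tor)
open Literature.MathematicalPhysics.QuantumFieldTheory.Balaban1983to89.QGQInverse (Coercive)
open Summit.QuantumFields.YangMills.BalabanUVNodes.N15KingModelRung.FreeField
open Summit.QuantumFields.YangMills.BalabanUVNodes.N15KingModelRung.OptimalDecay

variable {d : ℕ}

/-! ## §1 The finite-volume characteristic functional in closed form -/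

section Finite

variable {ι : Type*} [Fintype ι] [DecidableEq ι] {J : Type*}

/-- `J⬝φ = Σ_jc_jφ(b_j)` for the site vector `J = Σ_jc_jδ_{b_j}`. [folklore] -/
theorem dot_siteIndicator_eq_sum (T : Finset J) (c : J → ℝ) (b : J → ι) (φ : ι → ℝ) :
    (fun x : ι => ∑ j ∈ T, c j * (if x = b j then 1 else 0)) ⬝ᵥ φ = ∑ j ∈ T, c j * φ (b j) := by
  simp only [dotProduct, Finset.sum_mul]
  rw [Finset.sum_comm]
  refine Finset.sum_congr rfl fun j _ => ?_
  simp only [mul_assoc, ite_mul, one_mul, zero_mul]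
  rw [← Finset.mul_sum, Finset.sum_ite_eq' Finset.univ (b j)]
  simp

/-- `J⬝(KJ) = Σ_{j,j′}c_jc_{j′}K(b_j,b_{j′})` for `J = Σ_jc_jδ_{b_j}`. [folklore] -/
theorem dot_mulVec_siteIndicator_eq_sum (K : Matrix ι ι ℝ) (T : Finset J) (c : J → ℝ) (b : J → ι) :
    (fun x : ι => ∑ j ∈ T, c j * (if x = b j then 1 else 0)) ⬝ᵥ (K *ᵥ fun x : ι => ∑ j ∈ T, c j * (if x = b j then 1 else 0))
      = ∑ j ∈ T, ∑ j' ∈ T, c j * c j' * K (b j) (b j') := by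
  have h1 : (K *ᵥ fun x : ι => ∑ j ∈ T, c j * (if x = b j then 1 else 0)) = fun x => ∑ j' ∈ T, c j' * K x (b j') := by
    funext x
    change (fun y => K x y) ⬝ᵥ (fun y : ι => ∑ j ∈ T, c j * (if y = b j then 1 else 0)) = _
    rw [dotProduct_comm]
    exact dot_siteIndicator_eq_sum T c b _
  rw [h1, dot_siteIndicator_eq_sum]
  refine Finset.sum_congr rfl fun j _ => ?_
  rw [Finset.mul_sum]
  refine Finset.sum_congr rfl fun j' _ => ?_
  ring

/-- ★★ **THE FINITE-VOLUME CHARACTERISTIC FUNCTIONAL**: on a unit torus `Ω` (King's `K = ∞` fine block-average law `ρ_{P_∞,Ω}`, `P_∞⁻¹ = S₂^{(∞)}_Ω`; `L` odd, `L ≥ 2` only enter the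
tree's coercivity certificate), for block sites `b_j` and real `c_j`:  `∫ e^{iΣ_jc_jφ(b_j)} dρ_{P_∞,Ω} = exp(−½Σ_{j,j′}c_jc_{j′}S₂^{(∞)}_Ω(b_j,b_{j′}))` (part Ϝ-s's complex MGF at `z = i`).
[cite: King1986, (2.6) p.652, Thm 2.1 (2.22)–(2.23) p.654] -/
theorem integral_cexp_I_fieldSum_fineBlockLawLim (L : ℕ) (M : Fin (d + 1) → ℕ) [∀ ν, NeZero (M ν)] (hLodd : Odd L) (hL : 2 ≤ L) {m2 : ℝ} (hm : 0 < m2)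
    (T : Finset J) (c : J → ℝ) (b : J → Tor M) :
    ∫ φ, Complex.exp (((∑ j ∈ T, c j * φ (b j) : ℝ) : ℂ) * I) ∂gaussLaw (fineBlockPrecLim M m2)
      = Complex.exp (-(((∑ j ∈ T, ∑ j' ∈ T, c j * c j' * kingS2Lim M m2 (b j) (b j')) / 2 : ℝ) : ℂ)) := by
  set Jv : Tor M → ℝ := fun x => ∑ j ∈ T, c j * (if x = b j then 1 else 0) with hJv
  have hco := coercive_fineBlockPrecLim L M hLodd hL hm
  have h := complexMGF_dot_gaussLaw hm hco (fineBlockPrecLim_transpose M m2) Jv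
  have hI := congrFun h I
  rw [complexMGF_id_gaussianReal, complexMGF] at hI
  have hv : Jv ⬝ᵥ ((fineBlockPrecLim M m2)⁻¹ *ᵥ Jv) = ∑ j ∈ T, ∑ j' ∈ T, c j * c j' * kingS2Lim M m2 (b j) (b j') := by
    rw [fineBlockPrecLim_inv L M hLodd hL hm, hJv, dot_mulVec_siteIndicator_eq_sum]
    rfl
  have hvnn : 0 ≤ Jv ⬝ᵥ ((fineBlockPrecLim M m2)⁻¹ *ᵥ Jv) := dot_inv_mulVec_nonneg hm hco (fineBlockPrecLim_transpose M m2) Jv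
  have hpt : (fun ω : Tor M → ℝ => Complex.exp (I * ((Jv ⬝ᵥ ω : ℝ) : ℂ))) = fun φ => Complex.exp (((∑ j ∈ T, c j * φ (b j) : ℝ) : ℂ) * I) := by
    funext φ
    rw [hJv, dot_siteIndicator_eq_sum, mul_comm]
  rw [hpt] at hI
  rw [hI, Real.coe_toNNReal _ hvnn, hv]
  congr 1
  push_cast
  rw [Complex.I_sq]
  ring

end Finite

/-! ## §2 Convergence of the characteristic functionals -/

/-- ★★★ **THE THERMODYNAMIC LIMIT IN LÉVY's FORM — CONVERGENCE OF ALL FINITE-DIMENSIONAL DISTRIBUTIONS**: for sites `z : J → ℤ^{d+1}`, real coefficients `c`, `m² > 0`, and ANY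
sequence of unit tori `Ω_k = Π_νℤ∕M_{k,ν}` with every period `→ ∞`, the characteristic functionals of King's finite-volume `K = ∞` block-field laws converge to those of `μ_∞`:
`∫e^{iΣ_{j∈T}c_jφ(z_j mod Ω_k)}dρ_{P_∞,Ω_k} → ∫e^{iΣ_{j∈T}c_jφ(z_j)}dμ_∞`. [cite: King1986, Thm 2.1 (2.22)–(2.23) p.654, (4.5) p.670] -/
theorem tendsto_charFun_volume_kingFieldInf {m2 : ℝ} (hm : 0 < m2) (Mseq : ℕ → Fin (d + 1) → ℕ) (hpos : ∀ k ν, 0 < Mseq k ν)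
    (hlim : ∀ ν, Tendsto (fun k => (Mseq k ν : ℝ)) atTop atTop) {J : Type*} (T : Finset J) (c : J → ℝ) (z : J → Fin (d + 1) → ℤ) :
    Tendsto (fun k => haveI : ∀ ν, NeZero (Mseq k ν) := fun ν => ⟨(hpos k ν).ne'⟩
      ∫ φ, Complex.exp (((∑ j ∈ T, c j * φ (fun ν => ((z j ν : ℤ) : ZMod (Mseq k ν))) : ℝ) : ℂ) * I) ∂gaussLaw (fineBlockPrecLim (Mseq k) m2)) atTop
      (𝓝 (∫ ω, Complex.exp (((∑ j ∈ T, c j * ω (z j) : ℝ) : ℂ) * I) ∂kingFieldInf m2)) := by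
  have hL : 2 ≤ 3 := by norm_num
  have hLodd : Odd 3 := by decide
  -- both sides in closed form
  have e : (fun k => haveI : ∀ ν, NeZero (Mseq k ν) := fun ν => ⟨(hpos k ν).ne'⟩
      ∫ φ, Complex.exp (((∑ j ∈ T, c j * φ (fun ν => ((z j ν : ℤ) : ZMod (Mseq k ν))) : ℝ) : ℂ) * I) ∂gaussLaw (fineBlockPrecLim (Mseq k) m2))
      = fun k => haveI : ∀ ν, NeZero (Mseq k ν) := fun ν => ⟨(hpos k ν).ne'⟩
          Complex.exp (-(((∑ j ∈ T, ∑ j' ∈ T, c j * c j' * kingS2Lim (Mseq k) m2 (fun ν => ((z j ν : ℤ) : ZMod (Mseq k ν))) (fun ν => ((z j' ν : ℤ) : ZMod (Mseq k ν)))) / 2 : ℝ) : ℂ)) := by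
    funext k
    haveI : ∀ ν, NeZero (Mseq k ν) := fun ν => ⟨(hpos k ν).ne'⟩
    exact integral_cexp_I_fieldSum_fineBlockLawLim 3 (Mseq k) hLodd hL hm T c _
  rw [e, integral_cexp_I_fieldSum hm T z c]
  -- continuity of `x ↦ exp(−x∕2)` and the entrywise limits `S₂^{(∞)}_{Ω_k} → S₂^{ℝ}`
  have hsum : Tendsto (fun k => haveI : ∀ ν, NeZero (Mseq k ν) := fun ν => ⟨(hpos k ν).ne'⟩
      ∑ j ∈ T, ∑ j' ∈ T, c j * c j' * kingS2Lim (Mseq k) m2 (fun ν => ((z j ν : ℤ) : ZMod (Mseq k ν))) (fun ν => ((z j' ν : ℤ) : ZMod (Mseq k ν)))) atTop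
      (𝓝 (∑ j ∈ T, ∑ j' ∈ T, c j * c j' * kingS2Inf m2 (z j' - z j))) := by
    refine tendsto_finsetSum _ fun j _ => tendsto_finsetSum _ fun j' _ => ?_
    exact (tendsto_kingS2Lim_intCast_volume hm Mseq hpos hlim (z j) (z j')).const_mul _
  have hcont : Continuous fun x : ℝ => Complex.exp (-((x : ℝ) : ℂ)) := by fun_prop
  exact (hcont.tendsto _).comp (hsum.div_const 2)

end Summit.QuantumFields.YangMills.BalabanUVNodes.N15KingModelRung.InfiniteVolume
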